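import Summits.SmoothPoincare4.SmoothPoincare4.Theses.InformationMetricHadamard

/-!
# SmoothPoincare4 / InformationMetricHadamard — assembly

Settles item stmt-SmoothPoincare4-6018 (assembly of route InformationMetricHadamard, rev 2):
`C0AhRecognition → AhHadamardFilling → SmoothPoincare4`.

Pure logic.  For a Hausdorff second-countable smooth 4-manifold `M` homotopy equivalent to `S⁴`,
the proved packaging facts
`Literature.Topology.FourManifolds.compactSpace_of_homotopyEquiv_sphere_four_holds` /
`isOrientable_of_homotopyEquiv_sphere_four_holds` make `M` a `HomotopySphere 4`;
`AhHadamardFilling` supplies the Riemannian metric `g`, the Cartan–Hadamard 5-manifold `(W, G)`,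
the constant `c` and the C⁰-asymptotically-hyperbolic end collar `Φ`, and `C0AhRecognition`
applied to exactly that data gives `M ≃ₘ S⁴`, which is the shape of the problem statement
`SmoothPoincare4` (`= Literature.SPC4.SmoothPoincareConjectureFour.{0}`).  This is the route file's
own deciding theorem `InformationMetricHadamard.closes`; nothing else is used (no named unproved
facts).
-/

-- the registered namespace `Summit.SmoothPoincare4.SmoothPoincare4.Theorems` repeats a component
set_option linter.dupNamespace false

namespace Summit.SmoothPoincare4.SmoothPoincare4.Theorems

open Summit.SmoothPoincare4.SmoothPoincare4.Theses.InformationMetricHadamard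

/-- Settles stmt-SmoothPoincare4-6018: the assembly
`C0AhRecognition → AhHadamardFilling → SmoothPoincare4` of route InformationMetricHadamard.
Proof: apply the route's deciding theorem `InformationMetricHadamard.closes` (unfold
`SmoothPoincare4`, package `M` as a `HomotopySphere 4` with the proved compactness/orientability
facts, take the filling data `(g, W, G, c, Φ)` from `AhHadamardFilling`, feed it to
`C0AhRecognition`). [folklore] -/
theorem InformationMetricHadamard_Assembly_proof :
    Summit.SmoothPoincare4.SmoothPoincare4.Theses.InformationMetricHadamard.Assembly := by
  unfold Assembly
  intro hR hF
  exact closes hR hF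

end Summit.SmoothPoincare4.SmoothPoincare4.Theorems
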